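import Summits.QuantumFields.YangMills.Theorems.SwapVirialDeficitQuantitativeLaplaceStrongConvexOfHessian
import HarnessLib

/-!
# Route `SwapVirialDeficit` (YangMills): quantitative Laplace method — LIPSCHITZ HESSIAN FORMS from a third-derivative bound,
# coercivity transfer, fibre (partial) Hessians, and the LIPSCHITZ DEPENDENCE OF THE FIBRE MINIMISER on the base point

Width seat `ym-line-sfw-p2-w2` g58 (cell ym-idea-1, free hands), `--supports stmt-QuantumFields-24197`; the generic half of the LEAD g97 plan's
brick W6 (T2) «form-Lipschitz of the follower Hessian field `|⟪A_F(x)y,y⟫ − ⟪A_F(x′)y,y⟫| ≤ C·‖x − x′‖·‖y‖²`» and of the base-dependence control in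
(T1) (the follower minimiser `y⋆(x)` is Lipschitz in the leader position `x`).  Everything is stated for a `C³` (resp. `C²`) real function on a
real normed space with a bound on `‖D³F‖` (resp. `‖D²F‖`) on a CONVEX set; the model supplies the bounds from fcl-p3 g47's jets (J1–J3).

* §1 `norm_iteratedFDeriv_two_sub_le_of_third`, `norm_iteratedFDeriv_one_sub_le_of_second` — mean-value inequality for `D²F` ∕ `DF`
  (`‖D²F(x) − D²F(x′)‖ ≤ M₃‖x − x′‖` on a convex set carrying `‖D³F‖ ≤ M₃`).
* §2 ★★ `abs_hessianForm_sub_le_of_third` — `|D²F(x)[v,v] − D²F(x′)[v,v]| ≤ M₃‖x − x′‖‖v‖²`; `abs_fderiv_apply_sub_le_of_second`,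
  `norm_fderiv_sub_le_of_second` — `‖DF(x) − DF(x′)‖ ≤ M₂‖x − x′‖`.
* §3 ★★ `hessian_lower_of_third` ∕ `hessian_upper_of_third` — COERCIVITY TRANSFER: `λ‖v‖² ≤ D²F(x₀)[v,v]` ⟹ `(λ − M₃‖x − x₀‖)‖v‖² ≤ D²F(x)[v,v]`
  (and the upper analogue) — the input `hH` of ✓`strongConvex_of_hessian_lower` on a whole ball from the Hessian AT ONE POINT plus a `D³` bound.
* §4 `fderiv_fibre_apply`, ★ `iteratedFDeriv_two_fibre_apply` — partial derivatives along the fibre of `X × V` are the full derivatives on `(0, v)`: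
  `D(G(x,·))(y)[w] = DG(x,y)[(0,w)]`, `D²(G(x,·))(y)[v,v] = D²G(x,y)[(0,v),(0,v)]`.
* §5 ★★★ `abs_fibreHessianForm_sub_le_of_third` — (T2)-shape: `|D²_yG(x,y)[v,v] − D²_yG(x′,y′)[v,v]| ≤ M₃‖(x,y) − (x′,y′)‖‖v‖²`.
* §6 ★★ `norm_sub_le_of_strongConvex_of_critical` — for a `λ`-strongly convex (first-order form, as in ✓`exists_minimiser_of_strongConvex`) `F` with critical
  point `a`: `λ‖a − b‖ ≤ ‖DF(b)‖` for every `b` of the ball; ★★★ `norm_fibreMinimiser_sub_le` — critical points `a` of `G(x,·)` and `b` of `G(x′,·)`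
  satisfy `λ‖a − b‖ ≤ M₂‖x − x′‖` (`‖D²G‖ ≤ M₂` on a convex set containing `(x,b)`, `(x′,b)`): the fibre minimiser of ✓`exists_fibreMinimiser` is
  `M₂∕λ`-Lipschitz in the base point.

HONEST FRAMING: generic calculus; no model object (twistTrace, Haar, SU(2), jets) appears; ⟨24197⟩ `SwapGluedStiffness`, ⟨24196⟩, ⟨22884⟩ stay OPEN; no stub ∕
crux ∕ rung ∕ summit is closed; the Yang–Mills mass gap is NOT proved; no summit is proved by a line.  0 definitions, 0 `sorry`, standard axioms.
References: [cite: HasenpflugRudolfSprungk2024, §3.1] (assumptions of the fibred Laplace method), [folklore] (mean-value inequality, strong convexity).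
-/

set_option linter.style.longLine false
set_option linter.style.longFile 0
set_option linter.unusedSectionVars false

noncomputable section

open _root_.Set _root_.Metric

namespace Summit.QuantumFields.YangMills.Theorems.QuantitativeLaplace

/-! ### §1 Mean-value inequalities for `D²F` and `DF` -/

section One

variable {E : Type*} [NormedAddCommGroup E] [NormedSpace ℝ E]

/-- **`D²F` is `M₃`-Lipschitz on a convex set where `‖D³F‖ ≤ M₃`** (`F ∈ C³`). [folklore] -/
theorem norm_iteratedFDeriv_two_sub_le_of_third {F : E → ℝ} (hF : ContDiff ℝ 3 F) {s : Set E} (hs : Convex ℝ s) {M₃ : ℝ}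
    (hM : ∀ z ∈ s, ‖iteratedFDeriv ℝ 3 F z‖ ≤ M₃) {x x' : E} (hx : x ∈ s) (hx' : x' ∈ s) :
    ‖iteratedFDeriv ℝ 2 F x - iteratedFDeriv ℝ 2 F x'‖ ≤ M₃ * ‖x - x'‖ := by
  have hlt : ((2 : ℕ) : WithTop ℕ∞) < 3 := by exact_mod_cast (show (2 : ℕ) < 3 by norm_num)
  refine hs.norm_image_sub_le_of_norm_fderiv_le (fun z _ => hF.differentiable_iteratedFDeriv hlt z) (fun z hz => ?_) hx' hx
  rw [norm_fderiv_iteratedFDeriv]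
  exact hM z hz

/-- **`DF` (as `D¹F`) is `M₂`-Lipschitz on a convex set where `‖D²F‖ ≤ M₂`** (`F ∈ C²`). [folklore] -/
theorem norm_iteratedFDeriv_one_sub_le_of_second {F : E → ℝ} (hF : ContDiff ℝ 2 F) {s : Set E} (hs : Convex ℝ s) {M₂ : ℝ}
    (hM : ∀ z ∈ s, ‖iteratedFDeriv ℝ 2 F z‖ ≤ M₂) {x x' : E} (hx : x ∈ s) (hx' : x' ∈ s) :
    ‖iteratedFDeriv ℝ 1 F x - iteratedFDeriv ℝ 1 F x'‖ ≤ M₂ * ‖x - x'‖ := by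
  have hlt : ((1 : ℕ) : WithTop ℕ∞) < 2 := by exact_mod_cast (show (1 : ℕ) < 2 by norm_num)
  refine hs.norm_image_sub_le_of_norm_fderiv_le (fun z _ => hF.differentiable_iteratedFDeriv hlt z) (fun z hz => ?_) hx' hx
  rw [norm_fderiv_iteratedFDeriv]
  exact hM z hz

/-! ### §2 Lipschitz Hessian forms and gradients -/

/-- ★★ **Lipschitz HESSIAN FORM from a `D³` bound**: `|D²F(x)[v,v] − D²F(x′)[v,v]| ≤ M₃‖x − x′‖‖v‖²` for `x, x′` in a convex set carrying
`‖D³F‖ ≤ M₃`. [folklore] -/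
theorem abs_hessianForm_sub_le_of_third {F : E → ℝ} (hF : ContDiff ℝ 3 F) {s : Set E} (hs : Convex ℝ s) {M₃ : ℝ}
    (hM : ∀ z ∈ s, ‖iteratedFDeriv ℝ 3 F z‖ ≤ M₃) {x x' : E} (hx : x ∈ s) (hx' : x' ∈ s) (v : E) :
    |iteratedFDeriv ℝ 2 F x (fun _ => v) - iteratedFDeriv ℝ 2 F x' (fun _ => v)| ≤ M₃ * ‖x - x'‖ * ‖v‖ ^ 2 := by
  have h := norm_iteratedFDeriv_two_sub_le_of_third hF hs hM hx hx'
  have h2 := (iteratedFDeriv ℝ 2 F x - iteratedFDeriv ℝ 2 F x').le_opNorm (fun _ => v)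
  rw [_root_.sub_apply, Real.norm_eq_abs, Finset.prod_const, Finset.card_univ, Fintype.card_fin] at h2
  calc |iteratedFDeriv ℝ 2 F x (fun _ => v) - iteratedFDeriv ℝ 2 F x' (fun _ => v)|
      ≤ ‖iteratedFDeriv ℝ 2 F x - iteratedFDeriv ℝ 2 F x'‖ * ‖v‖ ^ 2 := h2
    _ ≤ M₃ * ‖x - x'‖ * ‖v‖ ^ 2 := by gcongr

/-- **Lipschitz GRADIENT from a `D²` bound, applied form**: `|DF(x)[w] − DF(x′)[w]| ≤ M₂‖x − x′‖‖w‖`. [folklore] -/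
theorem abs_fderiv_apply_sub_le_of_second {F : E → ℝ} (hF : ContDiff ℝ 2 F) {s : Set E} (hs : Convex ℝ s) {M₂ : ℝ}
    (hM : ∀ z ∈ s, ‖iteratedFDeriv ℝ 2 F z‖ ≤ M₂) {x x' : E} (hx : x ∈ s) (hx' : x' ∈ s) (w : E) :
    |fderiv ℝ F x w - fderiv ℝ F x' w| ≤ M₂ * ‖x - x'‖ * ‖w‖ := by
  have h := norm_iteratedFDeriv_one_sub_le_of_second hF hs hM hx hx'
  have h2 := (iteratedFDeriv ℝ 1 F x - iteratedFDeriv ℝ 1 F x').le_opNorm (fun _ => w)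
  rw [_root_.sub_apply, iteratedFDeriv_one_apply, iteratedFDeriv_one_apply, Real.norm_eq_abs, Finset.prod_const,
    Finset.card_univ, Fintype.card_fin, pow_one] at h2
  calc |fderiv ℝ F x w - fderiv ℝ F x' w| ≤ ‖iteratedFDeriv ℝ 1 F x - iteratedFDeriv ℝ 1 F x'‖ * ‖w‖ := h2
    _ ≤ M₂ * ‖x - x'‖ * ‖w‖ := by gcongr

/-- **Lipschitz GRADIENT from a `D²` bound, operator-norm form**: `‖DF(x) − DF(x′)‖ ≤ M₂‖x − x′‖`. [folklore] -/
theorem norm_fderiv_sub_le_of_second {F : E → ℝ} (hF : ContDiff ℝ 2 F) {s : Set E} (hs : Convex ℝ s) {M₂ : ℝ}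
    (hM : ∀ z ∈ s, ‖iteratedFDeriv ℝ 2 F z‖ ≤ M₂) {x x' : E} (hx : x ∈ s) (hx' : x' ∈ s) :
    ‖fderiv ℝ F x - fderiv ℝ F x'‖ ≤ M₂ * ‖x - x'‖ := by
  have hM0 : 0 ≤ M₂ := le_trans (norm_nonneg _) (hM x hx)
  refine ContinuousLinearMap.opNorm_le_bound _ (by positivity) fun w => ?_
  rw [_root_.sub_apply, Real.norm_eq_abs]
  exact abs_fderiv_apply_sub_le_of_second hF hs hM hx hx' w

/-! ### §3 Coercivity transfer -/

/-- ★★ **COERCIVITY TRANSFER (lower)**: a Hessian floor `λ‖v‖² ≤ D²F(x₀)[v,v]` at ONE point `x₀` and `‖D³F‖ ≤ M₃` on a convex set `s ∋ x₀, x` give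
`(λ − M₃‖x − x₀‖)‖v‖² ≤ D²F(x)[v,v]`. [folklore] -/
theorem hessian_lower_of_third {F : E → ℝ} (hF : ContDiff ℝ 3 F) {s : Set E} (hs : Convex ℝ s) {M₃ : ℝ}
    (hM : ∀ z ∈ s, ‖iteratedFDeriv ℝ 3 F z‖ ≤ M₃) {x₀ x : E} (hx₀ : x₀ ∈ s) (hx : x ∈ s) {lam : ℝ}
    (hlam : ∀ v : E, lam * ‖v‖ ^ 2 ≤ iteratedFDeriv ℝ 2 F x₀ (fun _ => v)) (v : E) :
    (lam - M₃ * ‖x - x₀‖) * ‖v‖ ^ 2 ≤ iteratedFDeriv ℝ 2 F x (fun _ => v) := by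
  have h := abs_hessianForm_sub_le_of_third hF hs hM hx hx₀ v
  have h1 := hlam v
  have h2 := (abs_le.1 h).1
  nlinarith

/-- ★★ **COERCIVITY TRANSFER (upper)**: `D²F(x₀)[v,v] ≤ Λ‖v‖²` at one point and `‖D³F‖ ≤ M₃` on a convex set give `D²F(x)[v,v] ≤ (Λ + M₃‖x − x₀‖)‖v‖²`.
[folklore] -/
theorem hessian_upper_of_third {F : E → ℝ} (hF : ContDiff ℝ 3 F) {s : Set E} (hs : Convex ℝ s) {M₃ : ℝ}
    (hM : ∀ z ∈ s, ‖iteratedFDeriv ℝ 3 F z‖ ≤ M₃) {x₀ x : E} (hx₀ : x₀ ∈ s) (hx : x ∈ s) {Lam : ℝ}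
    (hLam : ∀ v : E, iteratedFDeriv ℝ 2 F x₀ (fun _ => v) ≤ Lam * ‖v‖ ^ 2) (v : E) :
    iteratedFDeriv ℝ 2 F x (fun _ => v) ≤ (Lam + M₃ * ‖x - x₀‖) * ‖v‖ ^ 2 := by
  have h := abs_hessianForm_sub_le_of_third hF hs hM hx hx₀ v
  have h1 := hLam v
  have h2 := (abs_le.1 h).2
  nlinarith

/-- ★ **Coercivity on a whole ball from one point**: `λ‖v‖² ≤ D²F(x₀)[v,v]`, `‖D³F‖ ≤ M₃` on `B̄(x₀, r)` ⟹ `(λ − M₃ r)‖v‖² ≤ D²F(x)[v,v]` on `B̄(x₀,r)` — the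
hypothesis `hH` of ✓`strongConvex_of_hessian_lower` with `lam := λ − M₃ r`. [folklore] -/
theorem hessian_lower_on_closedBall_of_third {F : E → ℝ} (hF : ContDiff ℝ 3 F) {x₀ : E} {r M₃ : ℝ}
    (hM : ∀ z ∈ closedBall x₀ r, ‖iteratedFDeriv ℝ 3 F z‖ ≤ M₃) {lam : ℝ}
    (hlam : ∀ v : E, lam * ‖v‖ ^ 2 ≤ iteratedFDeriv ℝ 2 F x₀ (fun _ => v)) :
    ∀ x ∈ closedBall x₀ r, ∀ v : E, (lam - M₃ * r) * ‖v‖ ^ 2 ≤ iteratedFDeriv ℝ 2 F x (fun _ => v) := by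
  intro x hx v
  have hr : 0 ≤ r := le_trans dist_nonneg (mem_closedBall.1 hx)
  have hM0 : 0 ≤ M₃ := le_trans (norm_nonneg _) (hM x₀ (mem_closedBall_self hr))
  have h := hessian_lower_of_third hF (convex_closedBall x₀ r) hM (mem_closedBall_self hr) hx hlam v
  have hxr : ‖x - x₀‖ ≤ r := by rwa [mem_closedBall, dist_eq_norm] at hx
  have : (lam - M₃ * r) * ‖v‖ ^ 2 ≤ (lam - M₃ * ‖x - x₀‖) * ‖v‖ ^ 2 := by
    apply mul_le_mul_of_nonneg_right _ (sq_nonneg _)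
    nlinarith
  exact this.trans h

end One

/-! ### §4 Fibre (partial) derivatives on a product -/

section Fibre

variable {X : Type*} [NormedAddCommGroup X] [NormedSpace ℝ X] {V : Type*} [NormedAddCommGroup V] [NormedSpace ℝ V]

/-- **The fibre gradient is the full gradient on `(0, w)`**: `D(G(x,·))(y)[w] = DG(x,y)[(0,w)]`. [folklore] -/
theorem fderiv_fibre_apply {G : X × V → ℝ} {x : X} {y : V} (hG : DifferentiableAt ℝ G (x, y)) (w : V) :
    fderiv ℝ (fun y' => G (x, y')) y w = fderiv ℝ G (x, y) ((0 : X), w) := by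
  have h : HasFDerivAt (fun y' => G (x, y')) ((fderiv ℝ G (x, y)).comp (ContinuousLinearMap.inr ℝ X V)) y :=
    hG.hasFDerivAt.comp y (hasFDerivAt_prodMk_right (𝕜 := ℝ) x y)
  rw [h.fderiv, ContinuousLinearMap.comp_apply, ContinuousLinearMap.inr_apply]

/-- ★ **The fibre Hessian form is the full Hessian form on `(0, v)`**: `D²(G(x,·))(y)[v,v] = D²G(x,y)[(0,v),(0,v)]` (`G ∈ Cⁿ`, `2 ≤ n`). [folklore] -/
theorem iteratedFDeriv_two_fibre_apply {G : X × V → ℝ} {n : WithTop ℕ∞} (hG : ContDiff ℝ n G) (hn : (2 : WithTop ℕ∞) ≤ n) (x : X) (y v : V) :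
    iteratedFDeriv ℝ 2 (fun y' => G (x, y')) y (fun _ => v) = iteratedFDeriv ℝ 2 G (x, y) (fun _ => ((0 : X), v)) := by
  have hfun : (fun y' : V => G (x, y')) = (fun z : X × V => G ((x, (0 : V)) + z)) ∘ (ContinuousLinearMap.inr ℝ X V) := by
    funext y'
    simp only [Function.comp_apply, ContinuousLinearMap.inr_apply, Prod.mk_add_mk, add_zero, zero_add]
  have hGt : ContDiff ℝ n fun z : X × V => G ((x, (0 : V)) + z) := hG.comp (contDiff_const.add contDiff_id)
  rw [hfun, ContinuousLinearMap.iteratedFDeriv_comp_right _ hGt y (by exact_mod_cast hn),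
    ContinuousMultilinearMap.compContinuousLinearMap_apply, iteratedFDeriv_comp_add_left]
  simp only [ContinuousLinearMap.inr_apply, Prod.mk_add_mk, add_zero, zero_add]

/-! ### §5 (T2)-shape: Lipschitz fibre Hessian forms -/

/-- ★★★ **(T2)-shape — LIPSCHITZ FIBRE HESSIAN FORM**: for `G ∈ C³(X × V)` with `‖D³G‖ ≤ M₃` on a convex `s`, and `z = (x,y)`, `z′ = (x′,y′)` in `s`,
`|D²_yG(x,y)[v,v] − D²_yG(x′,y′)[v,v]| ≤ M₃‖z − z′‖‖v‖²`.  With `y = y⋆(x)`, `y′ = y⋆(x′)` the fibre minimisers and ✓`norm_fibreMinimiser_sub_le`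
(`‖y⋆(x) − y⋆(x′)‖ ≤ (M₂∕λ)‖x − x′‖`) this is the form-Lipschitz bound of the follower Hessian field `A_F(x) = D²_yG(x, y⋆(x))` in the leader position. [folklore] -/
theorem abs_fibreHessianForm_sub_le_of_third {G : X × V → ℝ} (hG : ContDiff ℝ 3 G) {s : Set (X × V)} (hs : Convex ℝ s) {M₃ : ℝ}
    (hM : ∀ z ∈ s, ‖iteratedFDeriv ℝ 3 G z‖ ≤ M₃) {z z' : X × V} (hz : z ∈ s) (hz' : z' ∈ s) (v : V) :
    |iteratedFDeriv ℝ 2 (fun y => G (z.1, y)) z.2 (fun _ => v) - iteratedFDeriv ℝ 2 (fun y => G (z'.1, y)) z'.2 (fun _ => v)| ≤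
      M₃ * ‖z - z'‖ * ‖v‖ ^ 2 := by
  have h2 : (2 : WithTop ℕ∞) ≤ 3 := by exact_mod_cast (show (2 : ℕ) ≤ 3 by norm_num)
  rw [iteratedFDeriv_two_fibre_apply hG h2 z.1 z.2 v, iteratedFDeriv_two_fibre_apply hG h2 z'.1 z'.2 v]
  have h := abs_hessianForm_sub_le_of_third hG hs hM hz hz' ((0 : X), v)
  have hn : ‖((0 : X), v)‖ = ‖v‖ := by simp [Prod.norm_def]
  rw [hn] at h
  exact h

end Fibre

/-! ### §6 Lipschitz dependence of the fibre minimiser on the base point -/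

section Minimiser

variable {V : Type*} [NormedAddCommGroup V] [NormedSpace ℝ V]

/-- ★★ **Distance to the critical point of a strongly convex function is controlled by the gradient**: if `F` is `λ`-strongly convex on `B̄(0,ρ)` in the
first-order form and `DF(a) = 0` at `a ∈ B̄(0,ρ)`, then `λ‖a − b‖ ≤ ‖DF(b)‖` for every `b ∈ B̄(0,ρ)`. [folklore] -/
theorem norm_sub_le_of_strongConvex_of_critical {F : V → ℝ} {lam ρ : ℝ}
    (hsc : ∀ x₀ ∈ closedBall (0 : V) ρ, ∀ x ∈ closedBall (0 : V) ρ,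
      F x₀ + fderiv ℝ F x₀ (x - x₀) + lam / 2 * ‖x - x₀‖ ^ 2 ≤ F x)
    {a b : V} (ha : a ∈ closedBall (0 : V) ρ) (hb : b ∈ closedBall (0 : V) ρ) (hFa : fderiv ℝ F a = 0) :
    lam * ‖a - b‖ ≤ ‖fderiv ℝ F b‖ := by
  have h1 := hsc a ha b hb
  rw [hFa, _root_.zero_apply, add_zero, norm_sub_rev] at h1
  have h2 := hsc b hb a ha
  have h3 : lam * ‖a - b‖ ^ 2 ≤ -(fderiv ℝ F b (a - b)) := by nlinarith
  have h4 : -(fderiv ℝ F b (a - b)) ≤ ‖fderiv ℝ F b‖ * ‖a - b‖ :=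
    (neg_le_abs _).trans (by rw [← Real.norm_eq_abs]; exact (fderiv ℝ F b).le_opNorm (a - b))
  by_cases hab : a = b
  · simp [hab]
  have hpos : 0 < ‖a - b‖ := norm_pos_iff.2 (sub_ne_zero.2 hab)
  nlinarith

variable {X : Type*} [NormedAddCommGroup X] [NormedSpace ℝ X]

/-- ★★★ **The fibre minimiser is LIPSCHITZ in the base point.**  `G ∈ C²(X × V)`, `‖D²G‖ ≤ M₂` on a convex `s`; the fibre `G(x,·)` is `λ`-strongly convex on
`B̄(0,ρ)` (first-order form); `a` is the critical point of `G(x,·)` and `b` a critical point of `G(x′,·)` in `B̄(0,ρ)`, with `(x,b), (x′,b) ∈ s`.  Then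
`λ‖a − b‖ ≤ M₂‖x − x′‖` (`λ‖a − b‖ ≤ ‖D_yG(x,b)‖ = ‖D_yG(x,b) − D_yG(x′,b)‖ ≤ M₂‖(x,b) − (x′,b)‖`). [folklore] -/
theorem norm_fibreMinimiser_sub_le {G : X × V → ℝ} (hG : ContDiff ℝ 2 G) {s : Set (X × V)} (hs : Convex ℝ s) {M₂ : ℝ}
    (hM : ∀ z ∈ s, ‖iteratedFDeriv ℝ 2 G z‖ ≤ M₂) {lam ρ : ℝ} {x x' : X}
    (hsc : ∀ y₀ ∈ closedBall (0 : V) ρ, ∀ y ∈ closedBall (0 : V) ρ,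
      G (x, y₀) + fderiv ℝ (fun y' => G (x, y')) y₀ (y - y₀) + lam / 2 * ‖y - y₀‖ ^ 2 ≤ G (x, y))
    {a b : V} (ha : a ∈ closedBall (0 : V) ρ) (hb : b ∈ closedBall (0 : V) ρ)
    (hGa : fderiv ℝ (fun y' => G (x, y')) a = 0) (hGb : fderiv ℝ (fun y' => G (x', y')) b = 0)
    (hxb : (x, b) ∈ s) (hx'b : (x', b) ∈ s) :
    lam * ‖a - b‖ ≤ M₂ * ‖x - x'‖ := by
  have h1 := norm_sub_le_of_strongConvex_of_critical (F := fun y' => G (x, y')) hsc ha hb hGa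
  have hM0 : 0 ≤ M₂ := le_trans (norm_nonneg _) (hM _ hxb)
  have hdiff : ∀ z : X × V, DifferentiableAt ℝ G z := fun z => (hG.differentiable (by norm_num)) z
  -- `‖D_yG(x,b)‖ ≤ M₂‖x − x′‖`
  have h2 : ‖fderiv ℝ (fun y' => G (x, y')) b‖ ≤ M₂ * ‖x - x'‖ := by
    refine ContinuousLinearMap.opNorm_le_bound _ (by positivity) fun w => ?_
    have hw : fderiv ℝ (fun y' => G (x, y')) b w = fderiv ℝ (fun y' => G (x, y')) b w - fderiv ℝ (fun y' => G (x', y')) b w := by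
      rw [hGb, _root_.zero_apply, sub_zero]
    rw [hw, fderiv_fibre_apply (hdiff (x, b)) w, fderiv_fibre_apply (hdiff (x', b)) w, Real.norm_eq_abs]
    have h := abs_fderiv_apply_sub_le_of_second hG hs hM hxb hx'b ((0 : X), w)
    have hn : ‖((0 : X), w)‖ = ‖w‖ := by simp [Prod.norm_def]
    have hn' : ‖((x, b) : X × V) - (x', b)‖ = ‖x - x'‖ := by simp [Prod.norm_def]
    rw [hn, hn'] at h
    exact h
  exact h1.trans h2

end Minimiser

end Summit.QuantumFields.YangMills.Theorems.QuantitativeLaplace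

end
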